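import Mathlib
import HarnessLib
import HarnessLib.Audit
import Summits.ValiantsHypothesis.ValiantsHypothesis.Theorems.LacunarySymmetroidMatrixDescartesZeroChangeFloorDictionary
import Summits.ValiantsHypothesis.ValiantsHypothesis.Theorems.LacunarySymmetroidMatrixDescartesZeroChangeFloorSymmetry

/-!
# ValiantsHypothesis / LacunarySymmetroid — crux `MatrixDescartes` (stmt-ValiantsHypothesis-18050, V1), LINE (A) «product_plus_one»:
# THEOREM D as a SIGN-CLASS CELL OF THE FLOOR `OneChangeFloorK3` (row scaling WLOG + ✓ `floor_smallRatio_le_two`)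

* `euler_scale_rows` — scaling row `j` of a company by `c_j` multiplies the (unfolded) Euler numerator by `C (∏ c_j)`; hence
  `card_posRoots_euler_scale_rows`: the floor count `Z₊(eulerNumerator d a l₀)` is unchanged when every `c_j ≠ 0` (every `K`, every coupling).
* ★ `floor_oneIncoherent_smallRatio_le_two` — THE CELL IN THE FLOOR'S OWN LANGUAGE: support `d₀ < d₁ < d₂` with `d₂ − d₀ ≤ 2(d₁ − d₀)`,
  a company `a : Fin m → Fin 3 → ℝ` with ONE row `j₀` of bottom-incoherent type (`a_{j₀0}·a_{j₀1} ≤ 0`, `a_{j₀0}·a_{j₀2} < 0`,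
  `a_{j₀1}·a_{j₀2} ≥ 0`: T5 `(+,−,−)` or its negative) and every other row one-signed with a nonzero bottom letter
  (`a_{j0}·a_{j1} ≥ 0`, `a_{j0}·a_{j2} ≥ 0`, `a_{j0} ≠ 0`: T1 up to sign) has `Z₊(eulerNumerator d a 0) ≤ 2` — for every `m` and every
  position `j₀` (rows normalised by `euler_scale_rows`, moved by ✓ `euler_reindex`, then ✓ `floor_smallRatio_le_two` = THEOREM D).
All such companies satisfy the floor's hypothesis `¬(a_{j0}a_{j1} < 0 ∧ a_{j1}a_{j2} < 0)`; the floor itself (all one-change companies, all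
ratios, a bound linear in `m`) is NOT proved.  HONEST FRAMING: helper; closes no stub; `MatrixDescartes` OPEN; `VP ≠ VNP` is NOT proved.
No definitions, no named facts, no sorry.
-/

set_option linter.dupNamespace false

namespace Summit.ValiantsHypothesis.ValiantsHypothesis.Theorems.LacunarySymmetroidMatrixDescartes

namespace ZeroChange

open Polynomial Finset

/-- **Scaling the rows scales the Euler numerator**: `E(c • a) = C(∏ c_j)·E(a)`. -/
theorem euler_scale_rows {m K : ℕ} (d : Fin K → ℕ) (a : Fin m → Fin K → ℝ) (l₀ : Fin K) (c : Fin m → ℝ) :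
    (∑ j, (∑ l, C ((c j * a j l) * ((d l : ℝ) - d l₀)) * X ^ (d l)) * ∏ i ∈ Finset.univ.erase j, (∑ l, C (c i * a i l) * X ^ (d l))
        : ℝ[X])
      = C (∏ j, c j) *
        ∑ j, (∑ l, C (a j l * ((d l : ℝ) - d l₀)) * X ^ (d l)) * ∏ i ∈ Finset.univ.erase j, (∑ l, C (a i l) * X ^ (d l)) := by
  rw [ProductPlusOne.eulerNumerator_eq_general d (fun j l => c j * a j l) l₀, ProductPlusOne.eulerNumerator_eq_general d a l₀]
  have hrow : ∀ j, (∑ l, C (c j * a j l) * X ^ (d l) : ℝ[X]) = C (c j) * ∑ l, C (a j l) * X ^ (d l) := by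
    intro j
    rw [Finset.mul_sum]
    exact Finset.sum_congr rfl fun l _ => by rw [C_mul, mul_assoc]
  have hP : (∏ j, ∑ l, C (c j * a j l) * X ^ (d l) : ℝ[X]) = C (∏ j, c j) * ∏ j, ∑ l, C (a j l) * X ^ (d l) := by
    rw [Finset.prod_congr rfl (fun j _ => hrow j), Finset.prod_mul_distrib, map_prod]
  rw [hP, derivative_mul, derivative_C, zero_mul, zero_add]
  ring

/-- Hence the floor count is unchanged by rescaling the rows with nonzero factors. -/
theorem card_posRoots_euler_scale_rows {m K : ℕ} (d : Fin K → ℕ) (a : Fin m → Fin K → ℝ) (l₀ : Fin K) (c : Fin m → ℝ)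
    (hc : ∀ j, c j ≠ 0) :
    ((∑ j, (∑ l, C ((c j * a j l) * ((d l : ℝ) - d l₀)) * X ^ (d l)) * ∏ i ∈ Finset.univ.erase j, (∑ l, C (c i * a i l) * X ^ (d l))
        : ℝ[X]).roots.toFinset.filter (fun t => 0 < t)).card
      = ((∑ j, (∑ l, C (a j l * ((d l : ℝ) - d l₀)) * X ^ (d l)) * ∏ i ∈ Finset.univ.erase j, (∑ l, C (a i l) * X ^ (d l))
        : ℝ[X]).roots.toFinset.filter (fun t => 0 < t)).card := by
  rw [euler_scale_rows, roots_C_mul _ (Finset.prod_ne_zero_iff.2 fun j _ => hc j)]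

/-- ★ **THEOREM D AS A SIGN-CLASS CELL OF THE FLOOR**: one bottom-incoherent row (T5 up to sign) in any position, all other rows one-signed
with nonzero bottom letter, ratio `d₂ − d₀ ≤ 2(d₁ − d₀)` ⇒ `Z₊(eulerNumerator d a 0) ≤ 2`, every `m`. -/
theorem floor_oneIncoherent_smallRatio_le_two {m : ℕ} (d : Fin 3 → ℕ) (h01 : d 0 < d 1) (h12 : d 1 < d 2)
    (hratio : d 2 - d 0 ≤ 2 * (d 1 - d 0)) (a : Fin (m + 1) → Fin 3 → ℝ) (j₀ : Fin (m + 1))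
    (hW : a j₀ 0 * a j₀ 1 ≤ 0 ∧ a j₀ 0 * a j₀ 2 < 0 ∧ 0 ≤ a j₀ 1 * a j₀ 2)
    (hB : ∀ j, j ≠ j₀ → 0 ≤ a j 0 * a j 1 ∧ 0 ≤ a j 0 * a j 2 ∧ a j 0 ≠ 0) :
    ((∑ j, (∑ l, C (a j l * ((d l : ℝ) - d 0)) * X ^ (d l)) * ∏ i ∈ Finset.univ.erase j, (∑ l, C (a i l) * X ^ (d l))
        : ℝ[X]).roots.toFinset.filter (fun t => 0 < t)).card ≤ 2 := by
  classical
  -- normalise the signs: the incoherent row to `(−,+,+)`, the others to a positive bottom letter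
  obtain ⟨c, hc⟩ : ∃ c : Fin (m + 1) → ℝ, ∀ j, c j = if j = j₀ then (if a j 0 < 0 then 1 else -1)
      else (if 0 < a j 0 then 1 else -1) := ⟨_, fun _ => rfl⟩
  have hc0 : ∀ j, c j ≠ 0 := by
    intro j; rw [hc]; split_ifs <;> norm_num
  have hcsq : ∀ j, c j * c j = 1 := by
    intro j; rw [hc]; split_ifs <;> norm_num
  -- move row `j₀` to position `0`
  set σ : Equiv.Perm (Fin (m + 1)) := Equiv.swap 0 j₀ with hσ
  set a' : Fin (m + 1) → Fin 3 → ℝ := fun j l => c (σ j) * a (σ j) l with ha'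
  have hE : ((∑ j, (∑ l, C (a' j l * ((d l : ℝ) - d 0)) * X ^ (d l)) * ∏ i ∈ Finset.univ.erase j, (∑ l, C (a' i l) * X ^ (d l))
        : ℝ[X]).roots.toFinset.filter (fun t => 0 < t)).card
      = ((∑ j, (∑ l, C (a j l * ((d l : ℝ) - d 0)) * X ^ (d l)) * ∏ i ∈ Finset.univ.erase j, (∑ l, C (a i l) * X ^ (d l))
        : ℝ[X]).roots.toFinset.filter (fun t => 0 < t)).card := by
    rw [ha']
    rw [card_posRoots_euler_reindex d (fun j l => c j * a j l) 0 σ, card_posRoots_euler_scale_rows d a 0 c hc0]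
  rw [← hE]
  -- the hypotheses of `floor_smallRatio_le_two` for `a'`
  have hσ0 : σ 0 = j₀ := by rw [hσ, Equiv.swap_apply_left]
  have hσs : ∀ i : Fin m, σ i.succ ≠ j₀ := by
    intro i h
    have h2 : σ (σ i.succ) = σ j₀ := by rw [h]
    rw [hσ, Equiv.swap_apply_self, Equiv.swap_apply_right] at h2
    exact (Fin.succ_ne_zero i) h2
  have hW' : a' 0 0 < 0 ∧ 0 ≤ a' 0 1 ∧ 0 < a' 0 2 := by
    simp only [ha', hσ0]
    have hcj : c j₀ = if a j₀ 0 < 0 then 1 else -1 := by rw [hc, if_pos rfl]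
    obtain ⟨h1, h2, h3⟩ := hW
    rcases lt_or_ge (a j₀ 0) 0 with hneg | hnn
    · rw [hcj, if_pos hneg]
      refine ⟨by linarith, ?_, ?_⟩
      · nlinarith
      · nlinarith
    · have hpos : 0 < a j₀ 0 := by
        rcases hnn.eq_or_lt with h0 | h0
        · rw [← h0, zero_mul] at h2; exact absurd h2 (lt_irrefl _)
        · exact h0
      rw [hcj, if_neg (not_lt.2 hnn)]
      refine ⟨by linarith, ?_, ?_⟩
      · nlinarith
      · nlinarith
  have hB' : ∀ i : Fin m, 0 < a' i.succ 0 ∧ 0 ≤ a' i.succ 1 ∧ 0 ≤ a' i.succ 2 := by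
    intro i
    simp only [ha']
    have hj : σ i.succ ≠ j₀ := hσs i
    obtain ⟨h1, h2, h3⟩ := hB (σ i.succ) hj
    have hcj : c (σ i.succ) = if 0 < a (σ i.succ) 0 then 1 else -1 := by rw [hc, if_neg hj]
    rcases lt_or_gt_of_ne h3 with hneg | hpos
    · rw [hcj, if_neg (not_lt.2 hneg.le)]
      refine ⟨by linarith, ?_, ?_⟩
      · nlinarith
      · nlinarith
    · rw [hcj, if_pos hpos]
      refine ⟨by linarith, ?_, ?_⟩
      · nlinarith
      · nlinarith
  exact floor_smallRatio_le_two d h01 h12 hratio a' hW' hB'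

end ZeroChange

end Summit.ValiantsHypothesis.ValiantsHypothesis.Theorems.LacunarySymmetroidMatrixDescartes
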